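import Summits.QuantumFields.BalabanUV.T4Continuum.Spine.NE1p.TiltedMeanInfluence
import Mathlib.Probability.Moments.SubGaussian

/-!
# BalabanUVNodes ∕ node N14 = NE1′ — THE COVARIANCE–GRADIENT ENGINE INTERFACE (`CovGradBound`, Helffer–Sjöstrand ∕ Brascamp–Lieb
# currency) and its bookkeeping down to the tree's `OldInfluenceProfile`; the Herbst currency of born cumulants (LENS control, card 1)

Cell `pub-ymgap`, HUMAN RULING D-0062 (Track A at full width), seat `pub-ymgap-dag-n14-c` (R134 ACCELERATION, strategy s1), generation 3;
route `Summits/QuantumFields/YangMills/Theses/BalabanUVNodes.lean` (cluster K3′ `SpineGivenEndpointR12`, `--supports … --as helper`); venue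
ruling R424 (`YangMills/Theorems`, namespace `YMDAG.N14.CovGradEngine`).  SPEC: the lens seat `ym-lens-BalabanUVNodes-control` (memo
`LENS-control.md` bdbc715bd5c6066f §1 ∕ §5 row s4 (b), sorried sketch `Sketch-control.lean` fc135459a54a09aa) — this file lands its card-1
signatures C1-a, C1-b, C1-b′, C1-c and card 3's C3-b SORRY-FREE, plus the bridge to `TiltedMeanInfluence.influence_eq_cov_div`.  Sibling:
`…N14VarianceSocket.lean` (cards 3 ∕ 2).  ADDITIVE — imports the gaps-ne1 module `Spine/NE1p/TiltedMeanInfluence` (`influence_eq_cov_div`,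
`TiltedMeanCrossover.OldInfluenceProfile`, `DressedMGFForm.tiltedMean`) and Mathlib's sub-Gaussian file ONLY; ONE interface `def` + theorems;
modifies nothing.

WHAT THIS IS.  The census of N14 (`pub-balaban-gaps/ne/NE1.md` R0–R69, this seat's r1–r13) buys the second order of every dressing channel
with a per-slot calculus (centring × decoupling, flatness × conjugation symmetry, commutators) whose decoupling input is booked as
«cluster-expansion KIND» (socket O-NE1′-2).  The control lens proposes ONE engine instead: a GRADIENT–GRADIENT COVARIANCE BOUND for the
(tilted, history-conditioned) fibre laws — the currency in which uniform convexity of Bałaban's small-field actions would be consumed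
(Bakry–Émery ⇒ Brascamp–Lieb ∕ Helffer–Sjöstrand).  This file types that currency and its bookkeeping, asserting nothing about Bałaban:
* §1 `bornCumulant_le_of_hasSubgaussianMGF` (C1-a, HERBST CURRENCY): a sub-Gaussian fibre law makes the born CUMULANT
  `cgf G κ t − t·E G` second order, `≤ c·t²∕2` (Mathlib `HasSubgaussianMGF.cgf_le`, `mgf_add_const`).
* §2 `CovGradBound μ Df Kk S` (C1-b, THE ENGINE SHAPE — hypothesis, NOT PRINTED for Bałaban's class ∕ fibre laws):
  `|∫fg dμ − ∫f dμ·∫g dμ| ≤ Σ_{b,b′ ∈ S} Df f b · Kk b b′ · Df g b′` over a finite bond set `S` (`Df f b` = sup-size of the `b`-th partial, or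
  the `b`-oscillation; `Kk` = the Witten-Laplacian ∕ Brascamp–Lieb kernel).  Bookkeeping: `cov_le_of_covGradBound` (C1-b′: observable with
  all partials `≤ θ` against a slot function with ℓ¹-gradient `≤ gsum`, kernel column sums `≤ CK` ⇒ `|Cov| ≤ θ·CK·gsum` — second order as
  soon as `gsum ∝ θ`; NO centring, flatness or symmetry), `var_le_of_covGradBound` (C3-b, the `f = g` case: `≤ θ²·CK·#S` — the ANOVA
  summand of a scale is natively second order), `CovGradBound.of_le` (kernel monotonicity).
* §3 `abs_influence_le_of_covGradBound` (BRIDGE to the tree): by `TiltedMeanInfluence.influence_eq_cov_div` the influence of re-weighting a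
  class law `ν` by a slot density ratio `r` on the tilted mean of `F` is `Cov_{ν_s}(F, r) ∕ E_{ν_s} r`; under the engine for the TILTED law
  `ν_s` it is `≤ θ·CK·gsum ∕ r₀` (`E_{ν_s} r ≥ r₀ > 0`) — the per-slot input of the ledger with no product structure.
* §4 `oldInfluenceProfile_of_secondOrder` (C1-c, TREE CURRENCY): per-slot second-order influences LINEAR in the slot's bond count,
  `|Δ K t τ s X| ≤ c·(θ₁^{K − sc K X})²·n K X`, with bond counts per scale `Σ_{sc = j} n ≤ vol·Λ^{K−j}`, give
  `TiltedMeanCrossover.OldInfluenceProfile l₀ T Bad wf sc Δ vol (fun K j => c·(θ₁²Λ)^{K−j})` — the ledger letter `a = θ₁²Λ` (`= L⁻²` at the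
  certified `θ₁ = L⁻³`, `Λ = L⁴`; cf. the tree's squared-amplitude version `TiltedMeanInfluence.oldInfluenceBudget_of_sq_amplitudes`, whose
  hypothesis is `(amp X)²` per slot — here the bound is linear in bond counts, no component-size moments).

WHAT THIS IS NOT.  [folklore] finite-sum bookkeeping and Mathlib's sub-Gaussian ∕ tilted-measure calculus; `CovGradBound` is a HYPOTHESIS
SHAPE: whether Bałaban's history-conditioned small-field fibre actions are uniformly convex on bi-Lipschitz-convex boxes (the located POSITIVITY
statement that would produce it, [Balaban1988RGII] (1.1)∕(2.20) KIND; kill-tests k1–k3 of the memo) is OBJECT-bound (NODE O) and NOT asserted;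
no log-Sobolev ∕ Brascamp–Lieb ∕ Helffer–Sjöstrand theorem is claimed or cited as proved here.  N14 NOT discharged; K3′ and `TiltedMeanMatching`
NOT instantiated; count-neutral.  One finite four-torus programme at fixed ε; NOT ℝ⁴, NOT OS, NOT a mass gap, NOT Clay.  0 sorry.
-/

noncomputable section

namespace YMDAG.N14.CovGradEngine

open MeasureTheory ProbabilityTheory Finset
open scoped ENNReal NNReal
open Summit.QuantumFields.BalabanUV.T4Continuum.NE1p
open Summit.QuantumFields.BalabanUV.T4Continuum.NE1p.DressedMGFForm (tiltedMean)
open Summit.QuantumFields.BalabanUV.T4Continuum.NE1p.TiltedMeanCrossover (OldInfluenceProfile)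
open Summit.QuantumFields.BalabanUV.T4Continuum.NE1p.TiltedMeanInfluence (influence_eq_cov_div)

/-! ## §1 Herbst currency: a sub-Gaussian fibre law makes the born cumulant second order -/

section Herbst

variable {Z : Type*} [MeasurableSpace Z] {κ : Measure Z} [IsProbabilityMeasure κ] {G : Z → ℝ} {c : ℝ≥0}

/-- The cumulant generating function of the CENTRED variable is the born cumulant: `cgf (G − E G) κ t = cgf G κ t − t·E G`, for `G` with
`e^{t(G − EG)}` integrable (Mathlib `mgf_add_const`, `mgf_pos`). [folklore] -/
theorem cgf_sub_integral_eq {t : ℝ} (hint : Integrable (fun z => Real.exp (t * (G z - ∫ w, G w ∂κ))) κ) :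
    cgf (fun z => G z - ∫ w, G w ∂κ) κ t = cgf G κ t - t * ∫ z, G z ∂κ := by
  set m := ∫ w, G w ∂κ with hm
  have hfun : (fun z => G z - m) = fun z => G z + (-m) := by funext z; ring
  -- `e^{tG} = e^{t(G − m)}·e^{tm}` is integrable, so `mgf G κ t > 0`
  have hintG : Integrable (fun z => Real.exp (t * G z)) κ := by
    have h := hint.mul_const (Real.exp (t * m))
    refine h.congr (ae_of_all _ fun z => ?_)
    simp only
    rw [← Real.exp_add]; congr 1; ring
  have hpos : 0 < mgf G κ t := mgf_pos hintG
  rw [cgf, hfun, mgf_add_const, Real.log_mul hpos.ne' (Real.exp_pos _).ne', Real.log_exp, cgf]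
  ring

/-- **HERBST CURRENCY** (LENS control, card 1 C1-a) [folklore].  If the centred fibre variable `G − E_κ G` has a sub-Gaussian moment
generating function with parameter `c` under the probability law `κ` (Mathlib `HasSubgaussianMGF`; the output of Herbst's argument from a
log-Sobolev constant, NOT asserted here for any law of Bałaban's), then the born CUMULANT is second order in the source:
`cgf G κ t − t·E_κ G ≤ c·t²∕2` for every real `t`. -/
theorem bornCumulant_le_of_hasSubgaussianMGF (h : HasSubgaussianMGF (fun z => G z - ∫ w, G w ∂κ) c κ) (t : ℝ) :
    cgf G κ t - t * ∫ z, G z ∂κ ≤ c * t ^ 2 / 2 := by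
  rw [← cgf_sub_integral_eq (h.integrable_exp_mul t)]
  exact h.cgf_le t

end Herbst

/-! ## §2 The engine shape `CovGradBound` and its bookkeeping -/

section Engine

variable {Ω Bd : Type*} [MeasurableSpace Ω]

/-- **THE COVARIANCE–GRADIENT ENGINE SHAPE** (LENS control, card 1 C1-b; hypothesis, NOT PRINTED for Bałaban's class ∕ fibre laws).  A
gradient–gradient covariance bound for the law `μ` with kernel `Kk` over the finite bond set `S`:
`|∫ f·g dμ − ∫ f dμ · ∫ g dμ| ≤ Σ_{b ∈ S} Σ_{b′ ∈ S} Df f b · Kk b b′ · Df g b′` for all real `f`, `g` — the Helffer–Sjöstrand ∕ Brascamp–Lieb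
currency (`Df f b` = the sup-size of the `b`-th partial derivative, or the `b`-oscillation, of `f`; `Kk` the inverse-Witten-Laplacian kernel).
In the application `μ` is a (tilted, history-conditioned) small-field fibre law; uniform convexity of its action on a convex box is what
would produce the shape (Bakry–Émery) — OBJECT-bound, not asserted. -/
def CovGradBound (μ : Measure Ω) (Df : (Ω → ℝ) → Bd → ℝ) (Kk : Bd → Bd → ℝ) (S : Finset Bd) : Prop :=
  ∀ f g : Ω → ℝ, |(∫ ω, f ω * g ω ∂μ) - (∫ ω, f ω ∂μ) * ∫ ω, g ω ∂μ| ≤ ∑ b ∈ S, ∑ b' ∈ S, Df f b * Kk b b' * Df g b'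

variable {μ : Measure Ω} {Df : (Ω → ℝ) → Bd → ℝ} {Kk Kk' : Bd → Bd → ℝ} {S : Finset Bd}

/-- KERNEL MONOTONICITY [folklore]: with nonnegative gradient sizes, a pointwise larger kernel on `S × S` keeps the engine shape. -/
theorem CovGradBound.of_le (h : CovGradBound μ Df Kk S) (hDf : ∀ f b, 0 ≤ Df f b)
    (hK : ∀ b ∈ S, ∀ b' ∈ S, Kk b b' ≤ Kk' b b') : CovGradBound μ Df Kk' S := by
  intro f g
  refine (h f g).trans (sum_le_sum fun b hb => sum_le_sum fun b' hb' => ?_)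
  exact mul_le_mul_of_nonneg_right (mul_le_mul_of_nonneg_left (hK b hb b' hb') (hDf f b)) (hDf g b')

omit [MeasurableSpace Ω] in
/-- The double sum against an observable with all partials `≤ θ` and kernel column sums `≤ CK` is at most `θ·CK·(ℓ¹-gradient of g)`
[folklore]. -/
theorem sum_sum_le_of_partials_le (hDf : ∀ f b, 0 ≤ Df f b) (hK : ∀ b b', 0 ≤ Kk b b') {F φ : Ω → ℝ} {θ CK : ℝ}
    (hθ : ∀ b ∈ S, Df F b ≤ θ) (hCK : ∀ b' ∈ S, ∑ b ∈ S, Kk b b' ≤ CK) (hθ0 : 0 ≤ θ) :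
    ∑ b ∈ S, ∑ b' ∈ S, Df F b * Kk b b' * Df φ b' ≤ θ * CK * ∑ b' ∈ S, Df φ b' := by
  calc ∑ b ∈ S, ∑ b' ∈ S, Df F b * Kk b b' * Df φ b'
      ≤ ∑ b ∈ S, ∑ b' ∈ S, θ * Kk b b' * Df φ b' :=
        sum_le_sum fun b hb => sum_le_sum fun b' _ =>
          mul_le_mul_of_nonneg_right (mul_le_mul_of_nonneg_right (hθ b hb) (hK b b')) (hDf φ b')
    _ = ∑ b' ∈ S, θ * (∑ b ∈ S, Kk b b') * Df φ b' := by
        rw [sum_comm]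
        refine sum_congr rfl fun b' _ => ?_
        rw [mul_sum, sum_mul]
    _ ≤ ∑ b' ∈ S, θ * CK * Df φ b' :=
        sum_le_sum fun b' hb' => mul_le_mul_of_nonneg_right (mul_le_mul_of_nonneg_left (hCK b' hb') hθ0) (hDf φ b')
    _ = θ * CK * ∑ b' ∈ S, Df φ b' := by rw [mul_sum]

/-- **BOOKKEEPING: UNIT OBSERVABLE × SLOT FUNCTION** (LENS control, card 1 C1-b′) [folklore].  Under `CovGradBound`, an observable read at
scale `j` with every partial `≤ θ` (`θ = θ₁^{K−j}` for the unit loop, `T4LoopPullback.theta1_exact`) against a slot function with ℓ¹-gradient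
`≤ gsum`, kernel column sums `≤ CK` (summable Combes–Thomas kernel), has covariance `≤ θ·CK·gsum` — SECOND order as soon as `gsum ∝ θ`
(the slot function is itself built from the observable).  No centring, no flatness, no symmetry is used. -/
theorem cov_le_of_covGradBound (h : CovGradBound μ Df Kk S) {F φ : Ω → ℝ} {θ CK gsum : ℝ} (hDf : ∀ f b, 0 ≤ Df f b)
    (hK : ∀ b b', 0 ≤ Kk b b') (hθ : ∀ b ∈ S, Df F b ≤ θ) (hCK : ∀ b' ∈ S, ∑ b ∈ S, Kk b b' ≤ CK)
    (hφ : ∑ b' ∈ S, Df φ b' ≤ gsum) (hθ0 : 0 ≤ θ) (hCK0 : 0 ≤ CK) :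
    |(∫ ω, F ω * φ ω ∂μ) - (∫ ω, F ω ∂μ) * ∫ ω, φ ω ∂μ| ≤ θ * CK * gsum :=
  ((h F φ).trans (sum_sum_le_of_partials_le hDf hK hθ hCK hθ0)).trans
    (mul_le_mul_of_nonneg_left hφ (mul_nonneg hθ0 hCK0))

/-- **SCALE CONTENT: THE `f = g` CASE** (LENS control, card 3 C3-b) [folklore].  Under the engine, the variance of the unit observable over
a fibre with `S.card` bonds, every partial `≤ θ` (`θ = θ₁^{K−j}`), kernel column sums `≤ CK`, is `≤ θ²·CK·S.card`: the ANOVA summand of scale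
`j` is natively SECOND order, so the old half of a variance ledger needs no dressing formalism at all. -/
theorem var_le_of_covGradBound (h : CovGradBound μ Df Kk S) {F : Ω → ℝ} {θ CK : ℝ} (hDf : ∀ f b, 0 ≤ Df f b)
    (hK : ∀ b b', 0 ≤ Kk b b') (hθ : ∀ b ∈ S, Df F b ≤ θ) (hCK : ∀ b' ∈ S, ∑ b ∈ S, Kk b b' ≤ CK) (hθ0 : 0 ≤ θ) :
    |(∫ ω, F ω * F ω ∂μ) - (∫ ω, F ω ∂μ) * ∫ ω, F ω ∂μ| ≤ θ ^ 2 * CK * S.card := by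
  rcases S.eq_empty_or_nonempty with hS | hS
  · have h0 := h F F
    rw [hS, sum_empty] at h0
    rw [hS, card_empty, Nat.cast_zero, mul_zero]
    exact h0
  obtain ⟨b₀, hb₀⟩ := hS
  have hCK0 : 0 ≤ CK := (sum_nonneg fun b _ => hK b b₀).trans (hCK b₀ hb₀)
  have hgrad : ∑ b' ∈ S, Df F b' ≤ θ * S.card := by
    calc ∑ b' ∈ S, Df F b' ≤ ∑ b' ∈ S, θ := sum_le_sum hθ
      _ = θ * S.card := by rw [sum_const, nsmul_eq_mul, mul_comm]
  calc |(∫ ω, F ω * F ω ∂μ) - (∫ ω, F ω ∂μ) * ∫ ω, F ω ∂μ| ≤ θ * CK * (θ * S.card) :=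
        cov_le_of_covGradBound h hDf hK hθ hCK hgrad hθ0 hCK0
    _ = θ ^ 2 * CK * S.card := by ring

end Engine

/-! ## §3 Bridge to the tree: the influence of a slot re-weighting on a tilted mean, under the engine for the tilted law -/

section Bridge

variable {Ω Bd : Type*} {mΩ : MeasurableSpace Ω} {ν : Measure Ω} [IsFiniteMeasure ν] [NeZero ν] {F : Ω → ℝ} {B : ℝ}
  {Df : (Ω → ℝ) → Bd → ℝ} {Kk : Bd → Bd → ℝ} {S : Finset Bd}

/-- **THE PER-SLOT INPUT WITHOUT PRODUCT STRUCTURE** [folklore].  `ν` a finite nonzero class law, `F` measurable with `|F| ≤ B`, `r ≥ 0` a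
measurable slot density ratio (re-sampled law `ν.withDensity r`), `ν_s := ν.tilted (sF)` the tilted probability law.  If the ENGINE holds for
`ν_s` with `F`'s partials `≤ θ`, the ratio's ℓ¹-gradient `≤ gsum`, kernel column sums `≤ CK`, and `E_{ν_s} r ≥ r₀ > 0`, then the influence of
the re-weighting on the tilted mean is `≤ θ·CK·gsum ∕ r₀` (`TiltedMeanInfluence.influence_eq_cov_div`: influence = `Cov_{ν_s}(F, r) ∕ E_{ν_s} r`).
With `gsum ∝ θ` (a slot ratio built from the transported observable) this is the second-order slot influence the ledger of §4 books. -/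
theorem abs_influence_le_of_covGradBound (hFm : Measurable F) (hF : ∀ ω, |F ω| ≤ B) {r : Ω → ℝ≥0} (hrm : Measurable r) (s : ℝ)
    (h : CovGradBound (ν.tilted fun ω => s * F ω) Df Kk S) {θ CK gsum r₀ : ℝ} (hDf : ∀ f b, 0 ≤ Df f b)
    (hK : ∀ b b', 0 ≤ Kk b b') (hθ : ∀ b ∈ S, Df F b ≤ θ) (hCK : ∀ b' ∈ S, ∑ b ∈ S, Kk b b' ≤ CK)
    (hgrad : ∑ b' ∈ S, Df (fun ω => (r ω : ℝ)) b' ≤ gsum) (hθ0 : 0 ≤ θ) (hCK0 : 0 ≤ CK) (hr₀ : 0 < r₀)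
    (hr : r₀ ≤ ∫ ω, (r ω : ℝ) ∂(ν.tilted fun ω => s * F ω)) :
    |tiltedMean F (ν.withDensity fun ω => r ω) s - tiltedMean F ν s| ≤ θ * CK * gsum / r₀ := by
  set R := ∫ ω, (r ω : ℝ) ∂(ν.tilted fun ω => s * F ω) with hR
  have hRpos : 0 < R := hr₀.trans_le hr
  have hcov := cov_le_of_covGradBound h (F := F) (φ := fun ω => (r ω : ℝ)) hDf hK hθ hCK hgrad hθ0 hCK0
  rw [influence_eq_cov_div hFm hF hrm s hRpos.ne', abs_div, abs_of_pos hRpos]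
  calc |(∫ ω, F ω * r ω ∂(ν.tilted fun ω => s * F ω))
          - (∫ ω, F ω ∂(ν.tilted fun ω => s * F ω)) * R| / R
      ≤ θ * CK * gsum / R := div_le_div_of_nonneg_right hcov hRpos.le
    _ ≤ θ * CK * gsum / r₀ :=
        div_le_div_of_nonneg_left (mul_nonneg (mul_nonneg hθ0 hCK0) ((sum_nonneg fun b _ => hDf _ b).trans hgrad)) hr₀ hr

end Bridge

/-! ## §4 Tree currency: second-order influences linear in bond counts ⇒ `OldInfluenceProfile` with the letter `θ₁²Λ` -/

section Ledger

variable {ι D : Type*} [DecidableEq ι] {l₀ vol : ℝ} {T : ℕ → Finset ι} {Bad : ℕ → ℝ → Finset ι}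
  {wf : ℕ → ι → Finset D} {sc : ℕ → D → ℕ} {Δ : ℕ → ℝ → ι → ℝ → D → ℝ}

/-- **SECOND-ORDER INFLUENCES, LINEAR IN BOND COUNTS ⇒ `OldInfluenceProfile` WITH THE LETTER `θ₁²Λ`** (LENS control, card 1 C1-c)
[folklore].  If on every good class and every tilt `|s| ≤ l₀` each slot's influence on this run's tilted first moment is second order in the
loop's sensitivity and LINEAR in the slot's bond count, `|Δ K t τ s X| ≤ c·(θ₁^{K − sc K X})²·n K X` (§3 with `gsum ∝ θ·n`), and the scale-`j`
slots carry at most `vol·Λ^{K−j}` bonds in total, then gen 3's one-run profile holds with `u K j = c·(θ₁²·Λ)^{K−j}`: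
`TiltedMeanCrossover.OldInfluenceProfile l₀ T Bad wf sc Δ vol (fun K j => c·(θ₁²Λ)^{K−j})` — ready for `tiltedMeanMatching_of_profile`.  At the
certified `θ₁ = L⁻³`, `Λ = L⁴` the letter is `L⁻² < 1` (`TiltedMeanInfluence.secondOrder_lt_one_lt_firstOrder`); no component-size moments
(cf. the squared-amplitude version `TiltedMeanInfluence.oldInfluenceBudget_of_sq_amplitudes`). -/
theorem oldInfluenceProfile_of_secondOrder {n : ℕ → D → ℝ} {c θ₁ Λ : ℝ}
    (hΔ : ∀ K (t : ℝ), |t| ≤ l₀ → ∀ τ ∈ T K \ Bad K t, ∀ s : ℝ, |s| ≤ l₀ →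
      ∀ X ∈ wf K τ, |Δ K t τ s X| ≤ c * (θ₁ ^ (K - sc K X)) ^ 2 * n K X)
    (hn : ∀ K (τ : ι), ∀ j ≤ K, ∑ X ∈ wf K τ with sc K X = j, n K X ≤ vol * Λ ^ (K - j)) (hc : 0 ≤ c) :
    OldInfluenceProfile l₀ T Bad wf sc Δ vol (fun K j => c * (θ₁ ^ 2 * Λ) ^ (K - j)) := by
  intro K t ht τ hτ s hs j hj
  have hτT : τ ∈ T K := (Finset.mem_sdiff.mp hτ).1
  have hcθ : 0 ≤ c * (θ₁ ^ (K - j)) ^ 2 := mul_nonneg hc (sq_nonneg _)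
  calc ∑ X ∈ wf K τ with sc K X = j, |Δ K t τ s X|
      ≤ ∑ X ∈ wf K τ with sc K X = j, c * (θ₁ ^ (K - j)) ^ 2 * n K X := by
        refine sum_le_sum fun X hX => ?_
        obtain ⟨hXw, hXj⟩ := mem_filter.mp hX
        have h := hΔ K t ht τ hτ s hs X hXw
        rwa [hXj] at h
    _ = c * (θ₁ ^ (K - j)) ^ 2 * ∑ X ∈ wf K τ with sc K X = j, n K X := by rw [mul_sum]
    _ ≤ c * (θ₁ ^ (K - j)) ^ 2 * (vol * Λ ^ (K - j)) := mul_le_mul_of_nonneg_left (hn K τ j hj) hcθ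
    _ = vol * (c * (θ₁ ^ 2 * Λ) ^ (K - j)) := by rw [mul_pow, ← pow_mul, ← pow_mul']; ring

end Ledger

end YMDAG.N14.CovGradEngine

end
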